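import Summits.NavierStokesRegularity.NavierStokesRegularity.Theorems.TypeICertificateLadderTargetLambEnergySlack
import Summits.NavierStokesRegularity.NavierStokesRegularity.Theorems.DssFarFieldSlavingBlowupTypeIDssProfileSimilarityEnstrophyLambCore
import Literature.Analysis.FluidPDE.EnstrophySplitting
import HarnessLib

/-!
# Crux `Target` = `TypeICertificateLadder.NoTypeIBlowup` (stmt-NavierStokesRegularity-1217), line
# `depletion-ladder`, stub S1 `stub_depletionBelowHalf`: DEPLETION versus SPECTRAL CONCENTRATION

`--supports stmt-NavierStokesRegularity-1217` (line `depletion-ladder`, skeleton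
`Cruxes/Target/Lines/depletion_ladder.lean`; the card's step "numerics → STRUCTURE OF NEAR-EXTREMISERS →
certified bound" for S1).

S1 asks for a constant `κ < 1/2` in the `L^∞`-constrained enstrophy-production inequality
`|∫ ⟪ω, Du ω⟫| ≤ κ ‖u‖_∞ ‖ω‖₂ ‖∇ω‖₂` (`ω = curl u`, `div u = 0`); the same trilinear form is
`∫⟪(u·∇)u, Δu⟫ = ∫⟪curl u × u, Δu⟫` (Lamb form; `RungReynoldsOne`'s `HolderYoungSlackAt θ`, sharp
constant `θ* = κ̂ ≈ 0.14` numerically, `Cruxes/RungReynoldsOne/ThetaStarNumerics.md`, kit j021500).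
Cauchy–Schwarz gives the constant `1`; its saturation needs `Δu` (anti)parallel to the Lamb vector,
which is ORTHOGONAL to `u` — whereas `∫⟪u, Δu⟫ = −‖∇u‖₂²` forces `Δu` to have a component ALONG `u`
of `L²`-size `≥ ‖∇u‖₂²/‖u‖₂`. Testing the Lamb vector against `Δu + λu`, `λ = ‖∇u‖₂²/‖u‖₂²`
(`‖Δu + λu‖₂² = ‖Δu‖₂² − ‖∇u‖₂⁴/‖u‖₂²`) gives the static Lamb–energy slack
(`sq_integral_inner_convect_laplacian_le`):

  `(∫⟪(u·∇)u, Δu⟫)² ≤ (∫ |u|²|curl u|²) · (‖Δu‖₂² − ‖∇u‖₂⁴/‖u‖₂²)`,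

hence, with `Q := ‖∇u‖₂⁴/(‖u‖₂²‖Δu‖₂²) ∈ (0, 1]` (spectral concentration: `= 1` iff `|ξ|²|û|²` is
supported on one shell) and the depletion ratio `R := ∫⟪(u·∇)u, Δu⟫/(‖u‖_∞‖∇u‖₂‖Δu‖₂)`:

  `R² + Q ≤ 1` (`sq_integral_inner_convect_laplacian_le_mul_one_sub`).

Consequences for S1: near-extremisers of `κ̂` (if `κ̂` were close to `1`) are necessarily BROADBAND
(`Q → 0`); the card's structural facts "single-shell fields have `J = 0`" (`Q = 1`) and "two-shell
fields with comparable energies are depleted" are quantified (e.g. shells `k, 2k` with equal energy: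
`Q = 25/34`, `R ≤ 0.52`). The complementary regime `Q → 0` (scale-separated energy and palinstrophy)
is where the card's transversality suppression `O(k₁/k₂)` acts; that half is NOT proved here.

WHAT THIS IS NOT: not a bound `κ̂ < 1` (on the line's class `Q` is not bounded below); a kernel-checked
structural constraint on near-extremisers. Elementary. [folklore]

References: Lu–Doering, Indiana Univ. Math. J. 57 (2008) 2693–2727 (enstrophy-production extremals);
Lemarié-Rieusset 2016, Thm. 11.2; Doering–Gibbon 1995, (1.4.20) (`‖∇u‖₂ = ‖curl u‖₂`).
-/

noncomputable section

open Set Filter Topology MeasureTheory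
open scoped RealInnerProductSpace ENNReal NNReal Laplacian ContDiff
open Literature.Analysis.FluidPDE

namespace Summit.NavierStokesRegularity.NavierStokesRegularity.Theorems.DepletionLadder

-- the problem directory repeats the summit name (`NavierStokesRegularity/NavierStokesRegularity`)
set_option linter.dupNamespace false

open Summit.NavierStokesRegularity.NavierStokesRegularity.Theorems.RungReynoldsOne
open Summit.NavierStokesRegularity.NavierStokesRegularity.Theorems.SimilarityEnstrophy

/-- **Static Lamb–energy slack (with the interpolation sign).** For a divergence-free
`v ∈ C³(ℝ³; ℝ³)` bounded by `M` with `v, ∇v, D²v, D³v ∈ L²`: `0 ≤ ∫‖Δv‖² − (∫|∇v|²_F)²/∫|v|²`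
(`= ‖Δv + λv‖₂²`) and `(∫⟪(v·∇)v, Δv⟫)² ≤ (∫|v|²|curl v|²)·(∫‖Δv‖² − (∫|∇v|²_F)²/∫|v|²)`.
Proof: `(v·∇)v = curl v × v + ∇(|v|²/2)` and `∫⟪∇(|v|²/2), Δv⟫ = 0` (`div Δv = 0`), so the
production is the Lamb pairing `∫⟪curl v × v, Δv⟫`; the Lamb vector is orthogonal to `v`, so for
`λ = ∫|∇v|²_F/∫|v|²` it equals `∫⟪curl v × v, Δv + λv⟫ ≤ ‖curl v × v‖₂‖Δv + λv‖₂`, and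
`‖Δv + λv‖₂² = ‖Δv‖₂² − (∫|∇v|²_F)²/∫|v|²` by `∫⟪v, Δv⟫ = −∫|∇v|²_F`. [folklore] -/
theorem sq_integral_inner_convect_laplacian_le'
    {v : EuclideanSpace ℝ (Fin 3) → EuclideanSpace ℝ (Fin 3)} (hv : ContDiff ℝ 3 v)
    (hdiv : VectorCalculus.IsDivFree v) {M : ℝ} (hM : ∀ x, ‖v x‖ ≤ M)
    (hv0 : ∫⁻ x, ‖v x‖ₑ ^ 2 < ⊤)
    (hv1 : ∫⁻ x, ENNReal.ofReal (frobeniusNormSq (fderiv ℝ v x)) < ⊤)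
    (hv2 : ∫⁻ x, ‖iteratedFDeriv ℝ 2 v x‖ₑ ^ 2 < ⊤)
    (hv3 : ∫⁻ x, ‖iteratedFDeriv ℝ 3 v x‖ₑ ^ 2 < ⊤) :
    0 ≤ (∫ x, ‖(Δ v) x‖ ^ 2) - (∫ x, frobeniusNormSq (fderiv ℝ v x)) ^ 2 / ∫ x, ‖v x‖ ^ 2 ∧
    (∫ x, ⟪convect v v x, (Δ v) x⟫) ^ 2 ≤
      (∫ x, ‖v x‖ ^ 2 * ‖curl v x‖ ^ 2) *
        ((∫ x, ‖(Δ v) x‖ ^ 2) - (∫ x, frobeniusNormSq (fderiv ℝ v x)) ^ 2 / ∫ x, ‖v x‖ ^ 2) := by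
  set e := EuclideanSpace.basisFun (Fin 3) ℝ with he
  have he1 : ∀ i, ‖e i‖ = 1 := fun i => by simp [he]
  have hM0 : 0 ≤ M := (norm_nonneg _).trans (hM 0)
  have hv2' : ContDiff ℝ 2 v := hv.of_le (by norm_num)
  have hv1' : ContDiff ℝ 1 v := hv.of_le (by norm_num)
  have hdv : Differentiable ℝ v := hv1'.differentiable one_ne_zero
  have hΔ1 : ContDiff ℝ 1 (Δ v) := contDiff_one_laplacian_of_contDiff_three hv
  -- the Bernoulli head
  set B : EuclideanSpace ℝ (Fin 3) → ℝ := fun y => ‖v y‖ ^ 2 / 2 with hB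
  have hBc : ContDiff ℝ 1 B := ((contDiff_norm_sq ℝ).comp hv1').div_const 2
  have hDB : ∀ x, fderiv ℝ B x = (innerSL ℝ (v x)).comp (fderiv ℝ v x) := fun x =>
    (hasFDerivAt_half_norm_sq (hdv x)).fderiv
  -- continuity
  have cv : Continuous v := hv.continuous
  have cDv : Continuous (fderiv ℝ v) := hv.continuous_fderiv (by norm_num)
  have cD2 : Continuous fun x => iteratedFDeriv ℝ 2 v x := hv.continuous_iteratedFDeriv (by norm_num)
  have cD3 : Continuous fun x => iteratedFDeriv ℝ 3 v x := hv.continuous_iteratedFDeriv (by norm_num)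
  have cdiv : ∀ i, Continuous fun x => fderiv ℝ v x (e i) := fun i => cDv.clm_apply continuous_const
  have cddv : ∀ i, Continuous fun x => fderiv ℝ (fun y => fderiv ℝ v y (e i)) x (e i) := fun i =>
    ((((hv2'.fderiv_right (m := 1) (by norm_num)).clm_apply contDiff_const).continuous_fderiv
      one_ne_zero).clm_apply continuous_const)
  have cΔ : Continuous (Δ v) := hΔ1.continuous
  have cdΔ : ∀ i, Continuous fun x => fderiv ℝ (Δ v) x (e i) := fun i =>
    (hΔ1.continuous_fderiv one_ne_zero).clm_apply continuous_const
  have c3D2 : Continuous fun x => (3 : ℝ) • iteratedFDeriv ℝ 2 v x := cD2.const_smul (3 : ℝ)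
  have c3D3 : Continuous fun x => (3 : ℝ) • iteratedFDeriv ℝ 3 v x := cD3.const_smul (3 : ℝ)
  have ccurl : Continuous (curl v) := continuous_curl hv1'
  have ccross : Continuous fun x => cross (curl v x) (v x) :=
    (crossCLM.continuous₂).comp (ccurl.prodMk cv) |>.congr (fun x => by simp [crossCLM_apply])
  have cB : Continuous B := hBc.continuous
  have cgB : Continuous (gradient B) :=
    (InnerProductSpace.toDual ℝ (EuclideanSpace ℝ (Fin 3))).symm.continuous.comp
      (hBc.continuous_fderiv one_ne_zero)
  -- pointwise norm bounds
  have n_Δ : ∀ x, ‖(Δ v) x‖ ≤ ‖(3 : ℝ) • iteratedFDeriv ℝ 2 v x‖ := fun x => by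
    rw [norm_smul, Real.norm_of_nonneg (by norm_num : (0 : ℝ) ≤ 3)]
    exact norm_laplacian_le_three_mul_norm_iteratedFDeriv_two hv2' x
  have n_dΔ : ∀ i x, ‖fderiv ℝ (Δ v) x (e i)‖ ≤ ‖(3 : ℝ) • iteratedFDeriv ℝ 3 v x‖ := fun i x => by
    rw [norm_smul, Real.norm_of_nonneg (by norm_num : (0 : ℝ) ≤ 3),
      fderiv_laplacian_apply_of_contDiff_three hv x (e i)]
    exact (norm_laplacian_le_three_mul_norm_iteratedFDeriv_two
      ((hv.fderiv_right (m := 2) (by norm_num)).clm_apply contDiff_const) x).trans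
      (mul_le_mul_of_nonneg_left (norm_iteratedFDeriv_fderiv_apply_basisFun_le hv 2 (by norm_num) x i)
        (by norm_num))
  have hin : ∀ i (y : EuclideanSpace ℝ (Fin 3)), ‖⟪e i, y⟫‖ ≤ ‖y‖ := fun i y =>
    (norm_inner_le_norm (𝕜 := ℝ) (e i) y).trans (by rw [he1, one_mul])
  have hDBle : ∀ x, ‖fderiv ℝ B x‖ ≤ ‖M * ‖fderiv ℝ v x‖‖ := fun x => by
    rw [hDB x]
    refine ((ContinuousLinearMap.opNorm_comp_le _ _).trans ?_).trans (Real.le_norm_self _)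
    rw [innerSL_apply_norm]
    exact mul_le_mul_of_nonneg_right (hM x) (norm_nonneg _)
  -- finite `L²` norms
  have l2smul3 : ∀ {n : ℕ}, ∫⁻ x, ‖iteratedFDeriv ℝ n v x‖ₑ ^ 2 < ⊤ →
      ∫⁻ x, ‖(3 : ℝ) • iteratedFDeriv ℝ n v x‖ₑ ^ 2 < ⊤ := by
    intro n h
    have : ∀ x, ‖(3 : ℝ) • iteratedFDeriv ℝ n v x‖ₑ ^ 2 =
        ENNReal.ofReal (3 ^ 2) * ‖iteratedFDeriv ℝ n v x‖ₑ ^ 2 := by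
      intro x
      rw [enorm_smul, mul_pow, Real.enorm_eq_ofReal (by norm_num : (0:ℝ) ≤ 3),
        ENNReal.ofReal_pow (by norm_num : (0:ℝ) ≤ 3)]
    simp_rw [this]
    rw [lintegral_const_mul' _ _ ENNReal.ofReal_ne_top]
    exact ENNReal.mul_lt_top ENNReal.ofReal_lt_top h
  have l2Δ : ∫⁻ x, ‖(3 : ℝ) • iteratedFDeriv ℝ 2 v x‖ₑ ^ 2 < ⊤ := l2smul3 hv2
  have l2dΔ : ∫⁻ x, ‖(3 : ℝ) • iteratedFDeriv ℝ 3 v x‖ₑ ^ 2 < ⊤ := l2smul3 hv3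
  have l2Δ' : ∫⁻ x, ‖(Δ v) x‖ₑ ^ 2 < ⊤ := lintegral_enorm_sq_lt_top_of_norm_le n_Δ l2Δ
  have l2Dv : ∫⁻ x, ‖fderiv ℝ v x‖ₑ ^ 2 < ⊤ := lintegral_enorm_sq_fderiv_lt_top hv1
  have l2div : ∀ i, ∫⁻ x, ‖fderiv ℝ v x (e i)‖ₑ ^ 2 < ⊤ := fun i =>
    lintegral_enorm_sq_lt_top_of_norm_le (fun x => by
      simpa [he1] using (fderiv ℝ v x).le_opNorm (e i)) l2Dv
  have l2ddv : ∀ i, ∫⁻ x, ‖fderiv ℝ (fun y => fderiv ℝ v y (e i)) x (e i)‖ₑ ^ 2 < ⊤ := fun i =>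
    lintegral_enorm_sq_lt_top_of_norm_le (fun x => norm_fderiv_fderiv_apply_basisFun_le hv2' x i) hv2
  have l2MDv : ∫⁻ x, ‖M * ‖fderiv ℝ v x‖‖ₑ ^ 2 < ⊤ :=
    lintegral_enorm_sq_const_mul_norm_lt_top M l2Dv
  have l2diB : ∀ i, ∫⁻ x, ‖fderiv ℝ B x (e i)‖ₑ ^ 2 < ⊤ := fun i =>
    lintegral_enorm_sq_lt_top_of_norm_le (fun x =>
      le_trans (by simpa [he1] using (fderiv ℝ B x).le_opNorm (e i)) (hDBle x)) l2MDv
  have l2gB : ∫⁻ x, ‖gradient B x‖ₑ ^ 2 < ⊤ :=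
    lintegral_enorm_sq_lt_top_of_norm_le (fun x => by
      rw [gradient, LinearIsometryEquiv.norm_map]; exact hDBle x) l2MDv
  have l2B : ∫⁻ x, ‖B x‖ₑ ^ 2 < ⊤ := by
    refine lintegral_enorm_sq_lt_top_of_norm_le (b := fun x => M / 2 * ‖v x‖) (fun x => ?_)
      (lintegral_enorm_sq_const_mul_norm_lt_top _ hv0)
    refine le_trans ?_ (Real.le_norm_self _)
    simp only [hB]
    rw [Real.norm_of_nonneg (by positivity)]
    nlinarith [hM x, norm_nonneg (v x)]
  have l2ω : ∫⁻ x, ‖curl v x‖ₑ ^ 2 < ⊤ :=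
    lintegral_enorm_sq_lt_top_of_norm_le (b := fun x => ‖curlCLM‖ * ‖fderiv ℝ v x‖)
      (fun x => (norm_curl_le v x).trans (Real.le_norm_self _))
      (lintegral_enorm_sq_const_mul_norm_lt_top _ l2Dv)
  have l2curl : ∫⁻ x, ‖M * ‖curl v x‖‖ₑ ^ 2 < ⊤ := lintegral_enorm_sq_const_mul_norm_lt_top M l2ω
  have hcr : ∀ x, ‖cross (curl v x) (v x)‖ ≤ ‖v x‖ * ‖curl v x‖ := fun x => by
    rw [norm_cross, mul_comm ‖v x‖]
    nlinarith [Real.sin_le_one (InnerProductGeometry.angle (curl v x) (v x)),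
      mul_nonneg (norm_nonneg (curl v x)) (norm_nonneg (v x))]
  have l2cross : ∫⁻ x, ‖cross (curl v x) (v x)‖ₑ ^ 2 < ⊤ := by
    refine lintegral_enorm_sq_lt_top_of_norm_le (b := fun x => M * ‖curl v x‖) (fun x => ?_) l2curl
    exact ((hcr x).trans (mul_le_mul_of_nonneg_right (hM x) (norm_nonneg _))).trans
      (Real.le_norm_self _)
  -- integrability
  have j1 : ∀ i, Integrable (fun x => ⟪fderiv ℝ (fun y => fderiv ℝ v y (e i)) x (e i), v x⟫)
      volume := fun i =>
    integrable_of_norm_le_mul_of_lintegral_sq ((cddv i).inner cv).aestronglyMeasurable (cddv i) cv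
      (l2ddv i) hv0 fun x => norm_inner_le_norm _ _
  have j2 : ∀ i, Integrable (fun x => ⟪fderiv ℝ v x (e i), fderiv ℝ v x (e i)⟫) volume := fun i =>
    integrable_of_norm_le_mul_of_lintegral_sq ((cdiv i).inner (cdiv i)).aestronglyMeasurable
      (cdiv i) (cdiv i) (l2div i) (l2div i) fun x => norm_inner_le_norm _ _
  have j3 : ∀ i, Integrable (fun x => ⟪fderiv ℝ v x (e i), v x⟫) volume := fun i =>
    integrable_of_norm_le_mul_of_lintegral_sq ((cdiv i).inner cv).aestronglyMeasurable (cdiv i) cv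
      (l2div i) hv0 fun x => norm_inner_le_norm _ _
  have iLapv : Integrable (fun x => ⟪v x, (Δ v) x⟫) volume :=
    integrable_of_norm_le_mul_of_lintegral_sq (cv.inner cΔ).aestronglyMeasurable cv c3D2
      hv0 l2Δ fun x => (norm_inner_le_norm _ _).trans (mul_le_mul_of_nonneg_left (n_Δ x) (norm_nonneg _))
  have icΔ : Integrable (fun x => ⟪cross (curl v x) (v x), (Δ v) x⟫) volume :=
    integrable_of_norm_le_mul_of_lintegral_sq (ccross.inner cΔ).aestronglyMeasurable ccross c3D2
      l2cross l2Δ fun x => (norm_inner_le_norm _ _).trans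
        (mul_le_mul_of_nonneg_left (n_Δ x) (norm_nonneg _))
  have igBΔ : Integrable (fun x => ⟪gradient B x, (Δ v) x⟫) volume :=
    integrable_of_norm_le_mul_of_lintegral_sq (cgB.inner cΔ).aestronglyMeasurable cgB c3D2
      l2gB l2Δ fun x => (norm_inner_le_norm _ _).trans
        (mul_le_mul_of_nonneg_left (n_Δ x) (norm_nonneg _))
  have mL : MemLp (fun x => cross (curl v x) (v x)) 2 volume :=
    (memLp_two_iff_integrable_sq_norm ccross.aestronglyMeasurable).2
      (integrable_sq_norm_of_lintegral_lt_top ccross l2cross)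
  have mΔ : MemLp (Δ v) 2 volume :=
    (memLp_two_iff_integrable_sq_norm cΔ.aestronglyMeasurable).2
      (integrable_sq_norm_of_lintegral_lt_top cΔ l2Δ')
  have mv : MemLp v 2 volume :=
    (memLp_two_iff_integrable_sq_norm cv.aestronglyMeasurable).2
      (integrable_sq_norm_of_lintegral_lt_top cv hv0)
  have isqv : Integrable (fun x => ‖v x‖ ^ 2) volume := integrable_sq_norm_of_lintegral_lt_top cv hv0
  have isqΔ : Integrable (fun x => ‖(Δ v) x‖ ^ 2) volume :=
    integrable_sq_norm_of_lintegral_lt_top cΔ l2Δ'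
  have isqc : Integrable (fun x => ‖cross (curl v x) (v x)‖ ^ 2) volume :=
    integrable_sq_norm_of_lintegral_lt_top ccross l2cross
  have ivo : Integrable (fun x => ‖v x‖ ^ 2 * ‖curl v x‖ ^ 2) volume := by
    refine integrable_of_norm_le_mul_of_lintegral_sq (a := fun x => M * ‖curl v x‖)
      (b := fun x => M * ‖curl v x‖) ((cv.norm.pow 2).mul (ccurl.norm.pow 2)).aestronglyMeasurable
      (continuous_const.mul ccurl.norm) (continuous_const.mul ccurl.norm) l2curl l2curl fun x => ?_
    rw [Real.norm_of_nonneg (by positivity), Real.norm_of_nonneg (mul_nonneg hM0 (norm_nonneg _))]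
    calc ‖v x‖ ^ 2 * ‖curl v x‖ ^ 2 ≤ M ^ 2 * ‖curl v x‖ ^ 2 := by gcongr; exact hM x
      _ = M * ‖curl v x‖ * (M * ‖curl v x‖) := by ring
  -- the gradient pairing `∫⟪∇B, Δv⟫ = 0` (`div Δv = 0`)
  have cdiB : ∀ i, Continuous fun x => fderiv ℝ B x (e i) := fun i =>
    (hBc.continuous_fderiv one_ne_zero).clm_apply continuous_const
  have hgradΔ : ∫ x, ⟪gradient B x, (Δ v) x⟫ = 0 := by
    refine integral_inner_gradient_eq_zero_of_isDivFree_R3 hBc hΔ1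
      (isDivFree_laplacian_of_contDiff_three hv hdiv) (fun i => ?_) (fun i => ?_) (fun i => ?_)
    · refine integrable_of_norm_le_mul_of_lintegral_sq
        ((continuous_const.inner cΔ).mul (cdiB i)).aestronglyMeasurable c3D2 (cdiB i) l2Δ (l2diB i)
        fun x => ?_
      rw [norm_mul]
      exact mul_le_mul ((hin i _).trans (n_Δ x)) le_rfl (norm_nonneg _) (norm_nonneg _)
    · refine integrable_of_norm_le_mul_of_lintegral_sq
        ((continuous_const.inner (cdΔ i)).mul cB).aestronglyMeasurable c3D3 cB l2dΔ l2B
        fun x => ?_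
      rw [norm_mul]
      exact mul_le_mul ((hin i _).trans (n_dΔ i x)) le_rfl (norm_nonneg _) (norm_nonneg _)
    · refine integrable_of_norm_le_mul_of_lintegral_sq
        ((continuous_const.inner cΔ).mul cB).aestronglyMeasurable c3D2 cB l2Δ l2B
        fun x => ?_
      rw [norm_mul]
      exact mul_le_mul ((hin i _).trans (n_Δ x)) le_rfl (norm_nonneg _) (norm_nonneg _)
  -- the production in Lamb form
  have hJ : ∫ x, ⟪convect v v x, (Δ v) x⟫ = ∫ x, ⟪cross (curl v x) (v x), (Δ v) x⟫ := by
    have hpt : ∀ x, ⟪convect v v x, (Δ v) x⟫ =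
        ⟪cross (curl v x) (v x), (Δ v) x⟫ + ⟪gradient B x, (Δ v) x⟫ := fun x => by
      rw [convect_self_eq_cross_curl_add_gradient (hdv x), inner_add_left]
    rw [integral_congr_ae (Eventually.of_forall hpt), integral_add icΔ igBΔ, hgradΔ, add_zero]
  -- `∫⟪v, Δv⟫ = −Z'`
  set Z' : ℝ := ∫ x, frobeniusNormSq (fderiv ℝ v x) with hZ'
  set E : ℝ := ∫ x, ‖v x‖ ^ 2 with hE
  set W' : ℝ := ∫ x, ‖(Δ v) x‖ ^ 2 with hW'
  have hE0 : 0 ≤ E := integral_nonneg fun x => sq_nonneg _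
  have hLapv := integral_sum_inner_fderiv_fderiv_eq_neg_integral_inner_laplacian hv2' hv1' j1 j2 j3
  have hsumZ : ∫ x, ∑ i, ⟪fderiv ℝ v x (e i), fderiv ℝ v x (e i)⟫ = Z' := by
    refine integral_congr_ae (Eventually.of_forall fun x => ?_)
    dsimp only
    rw [frobeniusNormSq_eq_sum e]
    exact Finset.sum_congr rfl fun i _ => real_inner_self_eq_norm_sq _
  have hvLap : ∫ x, ⟪v x, (Δ v) x⟫ = -Z' := by
    have h1 : ∫ x, ⟪v x, (Δ v) x⟫ = ∫ x, ⟪(Δ v) x, v x⟫ :=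
      integral_congr_ae (Eventually.of_forall fun x => real_inner_comm _ _)
    rw [h1]
    linarith [hLapv, hsumZ]
  -- `‖Δv + λ v‖₂² = W' − Z'²/E` at `λ = Z'/E`
  set lam : ℝ := Z' / E with hlam
  have hX2 : ∫ x, ‖(Δ v) x + lam • v x‖ ^ 2 = W' - Z' ^ 2 / E := by
    have hexp : ∀ x, ‖(Δ v) x + lam • v x‖ ^ 2 =
        ‖(Δ v) x‖ ^ 2 + 2 * lam * ⟪v x, (Δ v) x⟫ + lam ^ 2 * ‖v x‖ ^ 2 := by
      intro x
      rw [norm_add_sq_real, norm_smul, real_inner_smul_right, real_inner_comm, mul_pow,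
        Real.norm_eq_abs, sq_abs]
      ring
    have hA : Integrable (fun x => ‖(Δ v) x‖ ^ 2 + 2 * lam * ⟪v x, (Δ v) x⟫) volume :=
      isqΔ.add (iLapv.const_mul (2 * lam))
    have hBB : Integrable (fun x => lam ^ 2 * ‖v x‖ ^ 2) volume := isqv.const_mul (lam ^ 2)
    have hA2 : Integrable (fun x => 2 * lam * ⟪v x, (Δ v) x⟫) volume := iLapv.const_mul (2 * lam)
    rw [integral_congr_ae (Eventually.of_forall hexp), integral_add hA hBB, integral_add isqΔ hA2,
      integral_const_mul, integral_const_mul, hvLap]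
    rcases eq_or_lt_of_le hE0 with hE00 | hEpos
    · have hl0 : lam = 0 := by rw [hlam, ← hE00, div_zero]
      rw [hl0, ← hE00]
      simp [hW']
    · rw [hlam]
      field_simp
      ring
  have hX0 : 0 ≤ W' - Z' ^ 2 / E := by
    rw [← hX2]; exact integral_nonneg fun x => sq_nonneg _
  -- Cauchy–Schwarz in the blind direction
  have hCS : |∫ x, ⟪cross (curl v x) (v x), (Δ v) x⟫| ≤
      Real.sqrt (∫ x, ‖cross (curl v x) (v x)‖ ^ 2) * Real.sqrt (W' - Z' ^ 2 / E) := by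
    rw [← hX2]
    exact abs_integral_inner_le_of_inner_eq_zero (fun x => inner_cross_curl_self _ _) mL mΔ mv lam
  have ha20 : 0 ≤ ∫ x, ‖cross (curl v x) (v x)‖ ^ 2 := integral_nonneg fun x => sq_nonneg _
  have ha2P2 : (∫ x, ‖cross (curl v x) (v x)‖ ^ 2) ≤ ∫ x, ‖v x‖ ^ 2 * ‖curl v x‖ ^ 2 := by
    refine integral_mono isqc ivo fun x => ?_
    calc ‖cross (curl v x) (v x)‖ ^ 2 ≤ (‖v x‖ * ‖curl v x‖) ^ 2 :=
          pow_le_pow_left₀ (norm_nonneg _) (hcr x) 2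
      _ = ‖v x‖ ^ 2 * ‖curl v x‖ ^ 2 := by ring
  refine ⟨hX0, ?_⟩
  rw [hJ]
  have hsq := pow_le_pow_left₀ (abs_nonneg _) hCS 2
  rw [sq_abs, mul_pow, Real.sq_sqrt ha20, Real.sq_sqrt hX0] at hsq
  exact hsq.trans (mul_le_mul_of_nonneg_right ha2P2 hX0)

/-- **Static Lamb–energy slack** (second component of `sq_integral_inner_convect_laplacian_le'`):
`(∫⟪(v·∇)v, Δv⟫)² ≤ (∫|v|²|curl v|²)·(∫‖Δv‖² − (∫|∇v|²_F)²/∫|v|²)`. [folklore] -/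
theorem sq_integral_inner_convect_laplacian_le
    {v : EuclideanSpace ℝ (Fin 3) → EuclideanSpace ℝ (Fin 3)} (hv : ContDiff ℝ 3 v)
    (hdiv : VectorCalculus.IsDivFree v) {M : ℝ} (hM : ∀ x, ‖v x‖ ≤ M)
    (hv0 : ∫⁻ x, ‖v x‖ₑ ^ 2 < ⊤)
    (hv1 : ∫⁻ x, ENNReal.ofReal (frobeniusNormSq (fderiv ℝ v x)) < ⊤)
    (hv2 : ∫⁻ x, ‖iteratedFDeriv ℝ 2 v x‖ₑ ^ 2 < ⊤)
    (hv3 : ∫⁻ x, ‖iteratedFDeriv ℝ 3 v x‖ₑ ^ 2 < ⊤) :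
    (∫ x, ⟪convect v v x, (Δ v) x⟫) ^ 2 ≤
      (∫ x, ‖v x‖ ^ 2 * ‖curl v x‖ ^ 2) *
        ((∫ x, ‖(Δ v) x‖ ^ 2) - (∫ x, frobeniusNormSq (fderiv ℝ v x)) ^ 2 / ∫ x, ‖v x‖ ^ 2) := by
  obtain ⟨-, h⟩ := sq_integral_inner_convect_laplacian_le' hv hdiv hM hv0 hv1 hv2 hv3
  exact h

/-- **Depletion versus spectral concentration: `R² + Q ≤ 1`.** Same class; with
`Z := ∫|∇v|²_F = ∫|curl v|²`, `W := ∫‖Δv‖²`, `E := ∫|v|²` and `|v| ≤ M`: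
`(∫⟪(v·∇)v, Δv⟫)² ≤ M²·Z·W·(1 − Z²/(E·W))`, i.e. the depletion ratio
`R = ∫⟪(v·∇)v, Δv⟫/(M√Z√W)` (S1's `κ̂`, `HolderYoungSlackAt`'s `θ*`) and the spectral concentration
`Q = Z²/(EW) ∈ (0,1]` (`Z² ≤ EW` is `‖∇v‖₂² ≤ ‖v‖₂‖Δv‖₂`) satisfy `R² + Q ≤ 1`: saturation of the
Cauchy–Schwarz constant forces `Q → 0` (broadband fields), and a single-shell field (`Q = 1`) has zero
production. (`∫|curl v|² = ∫|∇v|²_F` by `integral_norm_curl_sq_eq_integral_frobeniusNormSq`.)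
[folklore] -/
theorem sq_integral_inner_convect_laplacian_le_mul_one_sub
    {v : EuclideanSpace ℝ (Fin 3) → EuclideanSpace ℝ (Fin 3)} (hv : ContDiff ℝ 3 v)
    (hdiv : VectorCalculus.IsDivFree v) {M : ℝ} (hM : ∀ x, ‖v x‖ ≤ M)
    (hv0 : ∫⁻ x, ‖v x‖ₑ ^ 2 < ⊤)
    (hv1 : ∫⁻ x, ENNReal.ofReal (frobeniusNormSq (fderiv ℝ v x)) < ⊤)
    (hv2 : ∫⁻ x, ‖iteratedFDeriv ℝ 2 v x‖ₑ ^ 2 < ⊤)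
    (hv3 : ∫⁻ x, ‖iteratedFDeriv ℝ 3 v x‖ₑ ^ 2 < ⊤) :
    (∫ x, ⟪convect v v x, (Δ v) x⟫) ^ 2 ≤
      M ^ 2 * (∫ x, frobeniusNormSq (fderiv ℝ v x)) * (∫ x, ‖(Δ v) x‖ ^ 2) *
        (1 - (∫ x, frobeniusNormSq (fderiv ℝ v x)) ^ 2 /
          ((∫ x, ‖v x‖ ^ 2) * ∫ x, ‖(Δ v) x‖ ^ 2)) := by
  obtain ⟨hX0, h⟩ := sq_integral_inner_convect_laplacian_le' hv hdiv hM hv0 hv1 hv2 hv3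
  have hM0 : 0 ≤ M := (norm_nonneg _).trans (hM 0)
  have hv2' : ContDiff ℝ 2 v := hv.of_le (by norm_num)
  have hv1' : ContDiff ℝ 1 v := hv.of_le (by norm_num)
  have cv : Continuous v := hv.continuous
  have cDv : Continuous (fderiv ℝ v) := hv.continuous_fderiv (by norm_num)
  have ccurl : Continuous (curl v) := continuous_curl hv1'
  -- `∫|curl v|² = ∫|∇v|²_F`
  have l2Dv : ∫⁻ x, ‖fderiv ℝ v x‖ₑ ^ 2 < ⊤ := lintegral_enorm_sq_fderiv_lt_top hv1
  have l2ω : ∫⁻ x, ‖curl v x‖ₑ ^ 2 < ⊤ :=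
    lintegral_enorm_sq_lt_top_of_norm_le (b := fun x => ‖curlCLM‖ * ‖fderiv ℝ v x‖)
      (fun x => (norm_curl_le v x).trans (Real.le_norm_self _))
      (lintegral_enorm_sq_const_mul_norm_lt_top _ l2Dv)
  have iF : Integrable (fun x => frobeniusNormSq (fderiv ℝ v x)) volume :=
    integrable_of_continuous_of_nonneg (continuous_frobeniusNormSq_fderiv hv2' (by simp))
      (fun x => frobeniusNormSq_nonneg _) hv1
  have iC : Integrable (fun x => ‖curl v x‖ ^ 2) volume :=
    integrable_sq_norm_of_lintegral_lt_top ccurl l2ω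
  have iT : Integrable (convect v v) volume :=
    integrable_of_norm_le_mul_of_lintegral_sq (cDv.clm_apply cv).aestronglyMeasurable cDv cv l2Dv hv0
      fun x => (fderiv ℝ v x).le_opNorm (v x)
  have hZ : ∫ x, ‖curl v x‖ ^ 2 = ∫ x, frobeniusNormSq (fderiv ℝ v x) :=
    integral_norm_curl_sq_eq_integral_frobeniusNormSq hv2' hdiv iF iC iT
  have hE0 : 0 ≤ ∫ x, ‖v x‖ ^ 2 := integral_nonneg fun x => sq_nonneg _
  have hW0 : 0 ≤ ∫ x, ‖(Δ v) x‖ ^ 2 := integral_nonneg fun x => sq_nonneg _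
  -- `∫|v|²|curl v|² ≤ M² ∫|curl v|²`
  have iMC : Integrable (fun x => M ^ 2 * ‖curl v x‖ ^ 2) volume := iC.const_mul _
  have isqc : Integrable (fun x => ‖v x‖ ^ 2 * ‖curl v x‖ ^ 2) volume := by
    refine iMC.mono' ((cv.norm.pow 2).mul (ccurl.norm.pow 2)).aestronglyMeasurable
      (Eventually.of_forall fun x => ?_)
    rw [Real.norm_of_nonneg (by positivity)]
    exact mul_le_mul_of_nonneg_right (pow_le_pow_left₀ (norm_nonneg _) (hM x) 2) (sq_nonneg _)
  have hP2 : ∫ x, ‖v x‖ ^ 2 * ‖curl v x‖ ^ 2 ≤ M ^ 2 * ∫ x, frobeniusNormSq (fderiv ℝ v x) := by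
    rw [← hZ, ← integral_const_mul]
    exact integral_mono isqc iMC fun x =>
      mul_le_mul_of_nonneg_right (pow_le_pow_left₀ (norm_nonneg _) (hM x) 2) (sq_nonneg _)
  have hZ0 : 0 ≤ ∫ x, frobeniusNormSq (fderiv ℝ v x) := integral_nonneg fun x => frobeniusNormSq_nonneg _
  refine (h.trans (mul_le_mul_of_nonneg_right hP2 hX0)).trans ?_
  -- algebra: `M² Z (W − Z²/E) = M² Z W (1 − Z²/(E W))` for `E, W > 0`; conventions `x/0 = 0` else
  generalize (∫ x, frobeniusNormSq (fderiv ℝ v x)) = Z at *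
  generalize (∫ x, ‖v x‖ ^ 2) = E at *
  generalize (∫ x, ‖(Δ v) x‖ ^ 2) = W at *
  rcases eq_or_lt_of_le hW0 with hW00 | hWpos
  · rw [← hW00]
    have h3 : 0 ≤ M ^ 2 * Z * (Z ^ 2 / E) := by positivity
    simp only [mul_zero, zero_mul, zero_sub, div_zero, sub_zero, mul_neg, neg_nonpos]
    exact h3
  rcases eq_or_lt_of_le hE0 with hE00 | hEpos
  · rw [← hE00]; simp
  refine le_of_eq ?_
  field_simp

end Summit.NavierStokesRegularity.NavierStokesRegularity.Theorems.DepletionLadder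

end
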